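import Literature.NumberTheory.EllipticCurves.TateCurve.TorsionGaloisModule
import HarnessLib

/-!
# The extension class of `0 → μ_N → E_q[N] → ℤ/N → 0` is the Kummer class of `q`; two-generator form
# of `Ker(G_K → Aut E_q[N]) = G_{K(ζ_N, Q)}` (Silverman, *Advanced Topics*, V §3; [EtTh] §1 p. 13)

Topic `Literature/NumberTheory/EllipticCurves/TateCurve`, namespace
`Literature.NumberTheory.EllipticCurves.TateCurve` (abc-iut cell, layer L2, L2-lead rulings #7 (R61)
(a)+(b); seat abc-iut-L2-t5; proof-only follow-up of `TorsionGaloisModule.lean`). Silverman, *Advanced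
Topics in the Arithmetic of Elliptic Curves*, V §3 (PDF pp. 394–399) and the PROOF OF PROP. V.6.1 (PDF p. 411, «φ : (ζ^ℤ·Q^ℤ)/q^ℤ ⥲ E_q[ℓ]», basis
`P₁ = φ(ζ)`, `P₂ = φ(Q)`, `P₁^σ = P₁`, `P₂^σ = P₁ + P₂`; cf. Exercise 5.13, p. 410): the field
`K(E_q[N])` is `K_N = K(ζ_N, q^{1/N})`, and the `G_K`-module `E_q[N]` is the extension of `ℤ/N` (trivial
action) by `μ_N` whose class in `H¹(G_K, μ_N)` is the Kummer class of `q`, i.e. whose connecting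
`1`-cocycle, in the basis `(φ(ζ_N), φ(Q))`, is `σ ↦ σ(Q)/Q`.

* `mem_ker_galoisRepTorsion_tateCurve_iff_of_roots` / `…_iff_fixing_adjoin_pair` — `σ ∈ G_K` acts
  trivially on `E_q[N](K̄)` iff `σ ζ_N = ζ_N ∧ σ Q = Q` for ONE chosen primitive `ζ_N` and ONE chosen
  `N`-th root `Q` of `q`, iff `σ` fixes `K⟮ζ_N, Q⟯` pointwise (the `ζ`/`r` quantifier shape of layer L2's
  genuine-model Tate clause `ThetaSetting.IsTateOrigin`, [EtTh] §1 p. 13 "`K_N := K(ζ_N, q_X^{1/N})`");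
* `exists_basis_kummer_galoisRepTorsion_tateCurve` — for `q = ↑qu`, `qu : Kˣ`, a primitive `ζu ∈ K̄ˣ`
  and `Qu ∈ K̄ˣ` with `Qu ^ N = algebraMap qu` (the `(a, α)` shape of the tree's Kummer-cocycle files,
  `KummerCocycleRepresentatives.lean`: cocycle `g ↦ g • α / α`): a basis `P₁, P₂` of `E_q[N]` with
  **`σ • P₂ − P₂ = i • P₁` whenever `σ • Qu / Qu = ζu ^ i`** and `σ • P₁ = c • P₁` whenever
  `σ • ζu = ζu ^ c` — the connecting cocycle IS the Kummer cocycle of `Qu` read in the basis `ζu`.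

LOCATOR ERRATUM for `TorsionGaloisModule.lean` (audit note N1, abc-iut-w5-d209): the printed source of the
basis/triangular-action statements there is the proof of Prop. V.6.1 (PDF p. 411) with Exercise 5.13, not
"Lemma V.5.2 (PDF p. 406)" (which is the twisting invariant `γ(E/K)`); content unaffected.
HONEST FRAMING: classical support for a GENUINE-model origin clause of the [EtTh] §1 setting (Tate curve
over a complete field, not tempered fundamental groups); nothing of [EtTh] is asserted; no side is taken on
[IUTchIII] Cor. 3.12. [cite: SilvermanATAEC1994, proof of Prop. V.6.1 (PDF p. 411)]
-/

noncomputable section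

open scoped Classical

open Field WeierstrassCurve

namespace Literature.NumberTheory.EllipticCurves.TateCurve

open SteinWuthrich2013

universe u

variable {K : Type u} [NontriviallyNormedField K] [CompleteSpace K] [IsUltrametricDist K] [CharZero K]
  (q : K) (hq0 : q ≠ 0) (hq : ‖q‖ < 1)

include hq0 hq in
/-- **`Ker(G_K → Aut E_q[N](K̄)) = G_{K(ζ_N, Q)}` for one primitive `N`-th root of unity `ζ_N` and one
`N`-th root `Q` of `q`** (Silverman ATAEC V §3: `K(E_q[N]) = K(ζ_N, q^{1/N})`): `σ` acts trivially on
the `N`-torsion of the Tate curve iff `σ ζ = ζ` and `σ Q = Q`. The generator-pair form of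
`mem_ker_galoisRepTorsion_tateCurve_iff`; classical support for the genuine-model Tate clause of
[EtTh] §1 p. 13, nothing of [EtTh] asserted. [cite: SilvermanATAEC1994, Thm. V.3.1 (c),(d) (PDF pp. 395–399)] -/
theorem mem_ker_galoisRepTorsion_tateCurve_iff_of_roots {N : ℕ} (hN : 0 < N) {ζ Q : AlgebraicClosure K}
    (hζ : IsPrimitiveRoot ζ N) (hQ : Q ^ N = algebraMap K (AlgebraicClosure K) q)
    (σ : absoluteGaloisGroup K) :
    σ ∈ (galoisRepTorsion (tateCurve q) (N : ℤ)).ker ↔ σ • ζ = ζ ∧ σ • Q = Q := by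
  haveI : NeZero N := ⟨hN.ne'⟩
  rw [mem_ker_galoisRepTorsion_tateCurve_iff q hq0 hq hN]
  refine ⟨fun h => ⟨h ζ (Or.inl hζ.pow_eq_one), h Q (Or.inr hQ)⟩, fun h x hx => ?_⟩
  obtain ⟨hσζ, hσQ⟩ := h
  rw [absoluteGaloisGroup.smul_def] at hσζ hσQ ⊢
  have hqb0 : algebraMap K (AlgebraicClosure K) q ≠ 0 := (_root_.map_ne_zero _).mpr hq0
  have hQ0 : Q ≠ 0 := by
    rintro rfl
    rw [zero_pow hN.ne'] at hQ
    exact hqb0 hQ.symm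
  rcases hx with hx | hx
  · -- `x` is a power of `ζ`
    obtain ⟨i, -, rfl⟩ := hζ.eq_pow_of_pow_eq_one hx
    rw [map_pow, hσζ]
  · -- `x = ζ^i · Q`
    have hw : (x * Q⁻¹) ^ N = 1 := by
      rw [mul_pow, inv_pow, hx, hQ, mul_inv_cancel₀ hqb0]
    obtain ⟨i, -, hi⟩ := hζ.eq_pow_of_pow_eq_one hw
    have hxi : x = ζ ^ i * Q := by rw [hi, inv_mul_cancel_right₀ hQ0]
    rw [hxi, map_mul, map_pow, hσζ, hσQ]

include hq0 hq in
/-- The same with the Galois condition read on `K(ζ_N, Q)`: `σ` acts trivially on `E_q[N](K̄)` iff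
`σ` fixes the intermediate field `K⟮ζ_N, Q⟯ = K_N` pointwise. [cite: SilvermanATAEC1994, Thm. V.3.1 (c),(d) (PDF pp. 395–399)] -/
theorem mem_ker_galoisRepTorsion_tateCurve_iff_fixing_adjoin_pair {N : ℕ} (hN : 0 < N)
    {ζ Q : AlgebraicClosure K} (hζ : IsPrimitiveRoot ζ N)
    (hQ : Q ^ N = algebraMap K (AlgebraicClosure K) q) (σ : absoluteGaloisGroup K) :
    σ ∈ (galoisRepTorsion (tateCurve q) (N : ℤ)).ker ↔
      absoluteGaloisGroup.toAlgEquiv K σ ∈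
        (IntermediateField.adjoin K ({ζ, Q} : Set (AlgebraicClosure K))).fixingSubgroup := by
  rw [mem_ker_galoisRepTorsion_tateCurve_iff_of_roots q hq0 hq hN hζ hQ,
    IntermediateField.mem_fixingSubgroup_iff, absoluteGaloisGroup.smul_def, absoluteGaloisGroup.smul_def]
  constructor
  · rintro ⟨hσζ, hσQ⟩ x hx
    induction hx using IntermediateField.adjoin_induction with
    | mem x hx =>
      rcases hx with rfl | hx
      · exact hσζ
      · rw [Set.mem_singleton_iff] at hx; subst hx; exact hσQ
    | algebraMap x => exact AlgEquiv.commutes _ x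
    | add x y _ _ ihx ihy => rw [map_add, ihx, ihy]
    | inv x _ ihx => rw [map_inv₀, ihx]
    | mul x y _ _ ihx ihy => rw [map_mul, ihx, ihy]
  · intro h
    exact ⟨h ζ (IntermediateField.subset_adjoin K _ (Set.mem_insert ζ {Q})),
      h Q (IntermediateField.subset_adjoin K _ (Set.mem_insert_of_mem ζ rfl))⟩

/-- **The extension class of `E_q[N]` is the Kummer class of `q`** (Silverman ATAEC V §3 and the proof
of Prop. V.6.1, PDF p. 411: `P₁ = φ(ζ)`, `P₂ = φ(Q)`, `P₂^σ = P₁ + P₂` when `Q^σ = ζQ`; general `N` as in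
Exercise 5.13: `0 → μ_N → E_q[N] → ℤ/Nℤ → 0`). For `q = ↑qu` (`qu : Kˣ`, `‖q‖ < 1`), a primitive `N`-th
root of unity `ζu ∈ K̄ˣ` and `Qu ∈ K̄ˣ` with `Qu^N = q` (the `(a, α)` shape of the tree's Kummer-cocycle
files), there is a basis `P₁, P₂` of the `N`-torsion of `E_q(K̄)` (every `N`-torsion point is
`a•P₁ + b•P₂`; relations exactly `N ∣ a ∧ N ∣ b`) on which `G_K` acts by `σ•P₁ = c•P₁` when
`σ•ζu = ζu^c` (so `i ↦ i•P₁` is a `G_K`-copy of `μ_N = ⟨ζu⟩`) and by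
**`σ•P₂ − P₂ = i•P₁` when `σ•Qu/Qu = ζu^i`**: the connecting `1`-cocycle `σ ↦ σ•P₂ − P₂` with values in
`⟨P₁⟩ ≅ μ_N` is the Kummer cocycle `σ ↦ σ•Qu/Qu` of `Qu = q^{1/N}`, i.e. `δ(1) =` the Kummer class of `q`
in `H¹(G_K, μ_N)`. Classical support for a GENUINE-model origin clause ([EtTh] §1 p. 13); nothing of
[EtTh] is asserted. [cite: SilvermanATAEC1994, proof of Prop. V.6.1 (PDF p. 411); Thm. V.3.1 (c),(d) (PDF pp. 395–399)] -/
theorem exists_basis_kummer_galoisRepTorsion_tateCurve (qu : Kˣ) (hqu : ‖(qu : K)‖ < 1) {N : ℕ}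
    (hN : 0 < N) {ζu Qu : (AlgebraicClosure K)ˣ} (hζ : IsPrimitiveRoot (ζu : AlgebraicClosure K) N)
    (hQ : Qu ^ N = Units.map (algebraMap K (AlgebraicClosure K) : K →* AlgebraicClosure K) qu) :
    ∃ P₁ P₂ : geomPoints (tateCurve (qu : K)),
      (N : ℤ) • P₁ = 0 ∧ (N : ℤ) • P₂ = 0 ∧
      (∀ P : geomPoints (tateCurve (qu : K)), (N : ℤ) • P = 0 → ∃ a b : ℤ, P = a • P₁ + b • P₂) ∧
      (∀ a b : ℤ, a • P₁ + b • P₂ = 0 ↔ (N : ℤ) ∣ a ∧ (N : ℤ) ∣ b) ∧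
      (∀ (σ : absoluteGaloisGroup K) (c : ℕ),
        absoluteGaloisGroup.toAlgEquiv K σ • ζu = ζu ^ c → σ • P₁ = c • P₁) ∧
      (∀ (σ : absoluteGaloisGroup K) (i : ℕ),
        absoluteGaloisGroup.toAlgEquiv K σ • Qu / Qu = ζu ^ i → σ • P₂ - P₂ = i • P₁) := by
  have hq0 : (qu : K) ≠ 0 := qu.ne_zero
  have hQ' : (Qu : AlgebraicClosure K) ^ N = algebraMap K (AlgebraicClosure K) (qu : K) := by
    have := congrArg (fun u : (AlgebraicClosure K)ˣ => (u : AlgebraicClosure K)) hQ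
    simpa only [Units.val_pow_eq_pow_val, Units.coe_map, MonoidHom.coe_coe] using this
  obtain ⟨φ, hsurj, hker, hequiv, -⟩ := uniformization_holds (qu : K) hq0 hqu
  obtain ⟨P₁, P₂, h1, h2, hgen, hrel, hchi, hkum⟩ :=
    exists_basis_of_uniformization hq0 hqu hsurj hker hequiv hN hζ hQ'
  refine ⟨P₁, P₂, h1, h2, hgen, hrel, fun σ c hc => hchi σ c ?_, fun σ i hi => ?_⟩
  · -- `σ • ζu = ζu ^ c` on values
    have := congrArg (fun u : (AlgebraicClosure K)ˣ => (u : AlgebraicClosure K)) hc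
    simpa only [AlgEquiv.smul_units_def, Units.coe_map, MonoidHom.coe_coe, Units.val_pow_eq_pow_val,
      ← absoluteGaloisGroup.smul_def] using this
  · -- `σ • Qu / Qu = ζu ^ i` ⇒ `σ Q = ζ^i · Q` ⇒ `σ • P₂ = P₂ + i • P₁`
    rw [div_eq_iff_eq_mul] at hi
    have hi' : σ • (Qu : AlgebraicClosure K) = (ζu : AlgebraicClosure K) ^ i * Qu := by
      have := congrArg (fun u : (AlgebraicClosure K)ˣ => (u : AlgebraicClosure K)) hi
      simpa only [AlgEquiv.smul_units_def, Units.coe_map, MonoidHom.coe_coe, Units.val_mul,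
        Units.val_pow_eq_pow_val, ← absoluteGaloisGroup.smul_def] using this
    rw [hkum σ i hi', add_sub_cancel_left]

end Literature.NumberTheory.EllipticCurves.TateCurve

end
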